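import Literature.MathematicalPhysics.QuantumFieldTheory.Balaban1983to89.B5Eq117TorusCarriers
import Literature.MathematicalPhysics.QuantumFieldTheory.Balaban1983to89.B10StarCount
import HarnessLib

/-!
# Route `UnitScaleTilt`, crux K1 «MinimiserStabilityRegPr» (stmt-QuantumFields-19200), route-R E′ S3 ∕ line «HKGK-ANALYTIC», row (R-loc) brick (2a) —
# THE TENT FORMULA: the `Q_k`-transpose of a coarse weight, READ ON ONE `k`-BLOCK, is AFFINE in one block coordinate per component:
# `f⟨L^k·y + j, μ⟩ = ((L^{d+1})^k)⁻¹·((j_μ + 1)·ν⟨y,μ⟩ + (L^k − 1 − j_μ)·ν⟨y − e_μ, μ⟩)` ([Balaban1984PropagatorsI] (1.18) transposed; this seat's LOCATE-RLOC 7deca12a §2)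

Cell `ym3-torus`, twin-width seat `ym-ust-19936-w8` (gen 5).  THEOREMS ONLY (0 `def`, 0 `sorry`); `--supports stmt-QuantumFields-19200 --as helper`, count-neutral.  YM₃ on T³ is a
ladder rung (R3), not the Clay problem; nothing here claims S3, hKg-K, ℛ-ROW★, E′, the stub, the crux, d = 4 or the mass gap.

WHY.  (R-loc) = local flat Bernstein for local solutions of `Δu = (Q_k)ᵀν`; its `ℓ⁻²` comes from the LOCAL STRUCTURE of the source: on each `k`-block every component of `f = (Q_k)ᵀν` is an
affine function of ONE block coordinate (this file), so two interior test bumps give the blockwise inverse estimate `Σ_B f² ≲ ℓ⁻⁴Σ_B u²` (brick (2b)(2c)), and the cutoff Caccioppoli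
✓`Prop7FlatCutoffCaccioppoli.caccioppoli_cutoff_sourced` (brick 1) closes.  The count behind the formula: the straight `μ`-contours of `L^k` bonds through the fine bond `(x, μ)`,
`x = L^k·y + j`, start at `x − te_μ`, `t < L^k`; for `t ≤ j_μ` the start lies in `B^k(y)`, for `j_μ < t < L^k` in `B^k(y − e_μ)` ((1.18): `(Q_kA)(c) = (L^{d+1})^{−k}·Σ_{x′∈B^k(c₋)} A([x′, x′(c)])`).

WHAT IS PROVED (ns `…Theorems.Prop7FlatTransposeTent`; any `P : Params`, `k ≤ m + K`; `f` given ABSTRACTLY by the pairing `hf : ∀ Y, Σ_c ν(c)·(bondAvgIter k Y)(c) = Σ_b f(b)·Y(b)` of ✓p681767).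
* §1 letters: `runSite_left_cancel` (the start of a straight contour through a given bond at a given step is unique), `tstep_add`, `unshift_add_unitVec`.
* §2 the two starts: `runSite_blockSiteK_sub` (`t ≤ j_μ`: start `L^k·y + (j − te_μ) ∈ B^k(y)`), `runSite_blockSiteK_unshift` (`j_μ < t < L^k`: start `L^k·(y − e_μ) + (j + (L^k − t)e_μ) ∈ B^k(y − e_μ)`);
  `exists_start_mem_iterBlock` (both cases: a start exists and lies in `B^k` of `y` resp. `y − e_μ`).
* §3 `transpose_apply_eq_sum_starts` — `f⟨x,μ⟩ = ((L^{d+1})^k)⁻¹·Σ_{t<L^k} ν⟨B^k-point of the start at step t, μ⟩`;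
  ★★★ `transpose_blockSiteK` — THE TENT FORMULA of the title; ★ `transpose_blockSiteK_affine` — the same as `α + β·j_μ` with `α = ((L^{d+1})^k)⁻¹(ν⟨y,μ⟩ + (L^k−1)ν⟨y−e_μ,μ⟩)`,
  `β = ((L^{d+1})^k)⁻¹(ν⟨y,μ⟩ − ν⟨y−e_μ,μ⟩)`.
HONEST SCOPE.  Finite combinatorics of (1.18); no analysis; nothing of Bałaban's estimates is asserted.  Bricks (2b)(2c) and the (R-loc) assembly are separate files.

References: T. Bałaban, CMP 95 (1984) 17–40 [Balaban1984PropagatorsI] ((1.6) p.18, (1.8) p.19, (1.18) p.20).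
-/

set_option autoImplicit false

noncomputable section

open scoped BigOperators

namespace Summit.QuantumFields.YangMills.Theorems.Prop7FlatTransposeTent

open Literature.MathematicalPhysics.QuantumFieldTheory.Balaban1983to89
open Finset LatticeFieldCalculus
open B10StarCount (sum_pbond)
open B5Prop11Plancherel (Tor fine unitVec)
open B5Block118 (bpt tstep iota up bpt_add_tstep)
open B5Eq117TorusCarriers (Mk EK blockSiteK EK_runSite_blockSiteK EK_blockSiteK blockSiteK_mem_iterBlock)
open B5Eq118OneStroke (bondAvgIter_eq_blockSum iterBlock iterBlockOf mem_iterBlock)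

variable {P : Params} {k : ℕ}

/-! ## §1 Letters -/

/-- The start of a straight contour is determined by its `t`-th point: `x′ + te_μ = x″ + te_μ ⇒ x′ = x″`. [cite: Balaban1984PropagatorsI, (1.8) p.19] -/
theorem runSite_left_cancel {j : ℕ} (μ : Fin P.d) (t : ℕ) {x' x'' : Site P j} (h : runSite x' μ t = runSite x'' μ t) : x' = x'' := by
  funext ν
  have hν := congrFun h ν
  by_cases hνμ : ν = μ
  · subst hνμ
    simpa [runSite] using hν
  · simpa [runSite, Function.update_of_ne hνμ] using hν

/-- `(s + t)·e_μ = s·e_μ + t·e_μ` on the fine carrier. [folklore] -/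
theorem tstep_add (μ : Fin P.d) (s t : ℕ) :
    tstep (fine (P.L ^ k) (Mk P k)) μ (s + t) = tstep (fine (P.L ^ k) (Mk P k)) μ s + tstep (fine (P.L ^ k) (Mk P k)) μ t := by
  funext ν
  simp only [tstep, Pi.add_apply]
  split_ifs
  · push_cast; rfl
  · rw [add_zero]

/-- `(y − e_μ) + e_μ = y` (the `Setup` unshift against the carrier's unit vector). [folklore] -/
theorem unshift_add_unitVec (y : Site P k) (μ : Fin P.d) : (show Tor (Mk P k) from y.unshift μ) + unitVec (Mk P k) μ = y := by
  funext ν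
  by_cases hν : ν = μ
  · subst hν
    simp [Site.unshift, unitVec]
  · simp [Site.unshift, unitVec, Function.update_of_ne hν, Pi.single_eq_of_ne hν]

/-! ## §2 The two starts of the contours through `(L^k·y + j, μ)` -/

/-- **START INSIDE `B^k(y)`** (`t ≤ j_μ`): `(L^k·y + (j − te_μ)) + te_μ = L^k·y + j`. [cite: Balaban1984PropagatorsI, (1.18) p.20] -/
theorem runSite_blockSiteK_sub (y : Site P k) (j : Fin P.d → Fin (P.L ^ k)) (μ : Fin P.d) {t : ℕ} (ht : t ≤ (j μ : ℕ)) :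
    runSite (blockSiteK k y (Function.update j μ ⟨(j μ : ℕ) - t, by omega⟩)) μ t = blockSiteK k y j := by
  funext ν
  by_cases hν : ν = μ
  · subst hν
    simp only [runSite, Function.update_self, blockSiteK]
    push_cast
    rw [Nat.cast_sub ht]
    ring
  · simp only [runSite, Function.update_of_ne hν, blockSiteK]

/-- **START INSIDE `B^k(y − e_μ)`** (`j_μ < t ≤ L^k`): `(L^k·(y − e_μ) + (j + (L^k − t)e_μ)) + te_μ = L^k·y + j` (through the carrier dictionary `EK`: `bpt (y − e_μ) j′ + t·e = bpt (y − e_μ) j + L^k·e = bpt y j`,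
✓`bpt_add_tstep`). [cite: Balaban1984PropagatorsI, (1.18) p.20] -/
theorem runSite_blockSiteK_unshift (hk : k ≤ P.m + P.K) (y : Site P k) (j : Fin P.d → Fin (P.L ^ k)) (μ : Fin P.d) {t : ℕ}
    (ht : (j μ : ℕ) < t) (htl : t ≤ P.L ^ k) :
    runSite (blockSiteK k (y.unshift μ) (Function.update j μ ⟨(j μ : ℕ) + (P.L ^ k - t), by omega⟩)) μ t = blockSiteK k y j := by
  apply (EK hk).injective
  rw [EK_runSite_blockSiteK, EK_blockSiteK]
  -- `iota j′ = iota j + (L^k − t)·e_μ`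
  have hiota : iota (P.L ^ k) (Mk P k) (Function.update j μ ⟨(j μ : ℕ) + (P.L ^ k - t), by omega⟩)
      = iota (P.L ^ k) (Mk P k) j + tstep (fine (P.L ^ k) (Mk P k)) μ (P.L ^ k - t) := by
    funext ν
    by_cases hν : ν = μ
    · subst hν
      simp only [iota, Function.update_self, tstep, Pi.add_apply, if_true]
      push_cast
      rfl
    · simp only [iota, Function.update_of_ne hν, tstep, Pi.add_apply, if_neg hν, add_zero]
  have hsum : P.L ^ k - t + t = P.L ^ k := Nat.sub_add_cancel htl
  calc bpt (P.L ^ k) (Mk P k) (y.unshift μ) (Function.update j μ ⟨(j μ : ℕ) + (P.L ^ k - t), by omega⟩) + tstep (fine (P.L ^ k) (Mk P k)) μ t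
      = bpt (P.L ^ k) (Mk P k) (y.unshift μ) j + (tstep (fine (P.L ^ k) (Mk P k)) μ (P.L ^ k - t) + tstep (fine (P.L ^ k) (Mk P k)) μ t) := by
        simp only [bpt, hiota]; abel
    _ = bpt (P.L ^ k) (Mk P k) (y.unshift μ) j + tstep (fine (P.L ^ k) (Mk P k)) μ (P.L ^ k) := by rw [← tstep_add, hsum]
    _ = bpt (P.L ^ k) (Mk P k) ((show Tor (Mk P k) from y.unshift μ) + unitVec (Mk P k) μ) j := bpt_add_tstep (P.L ^ k) (Mk P k) _ j μ
    _ = bpt (P.L ^ k) (Mk P k) y j := by rw [unshift_add_unitVec]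

/-- **FOR EVERY STEP `t < L^k` THERE IS A START, AND IT LIES IN `B^k(y)` OR `B^k(y − e_μ)`** according as `t ≤ j_μ` or not. [cite: Balaban1984PropagatorsI, (1.18) p.20] -/
theorem exists_start_mem_iterBlock (hk : k ≤ P.m + P.K) (y : Site P k) (j : Fin P.d → Fin (P.L ^ k)) (μ : Fin P.d) {t : ℕ} (htl : t < P.L ^ k) :
    ∃ x' : Site P 0, runSite x' μ t = blockSiteK k y j ∧ x' ∈ iterBlock k (if t ≤ (j μ : ℕ) then y else y.unshift μ) := by
  by_cases ht : t ≤ (j μ : ℕ)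
  · refine ⟨_, runSite_blockSiteK_sub y j μ ht, ?_⟩
    rw [if_pos ht]
    exact blockSiteK_mem_iterBlock hk y _
  · refine ⟨_, runSite_blockSiteK_unshift hk y j μ (lt_of_not_ge ht) htl.le, ?_⟩
    rw [if_neg ht]
    exact blockSiteK_mem_iterBlock hk (y.unshift μ) _

/-! ## §3 The tent formula -/

/-- **THE TRANSPOSE AS A SUM OVER STARTS**: `f⟨x,μ⟩ = ((L^{d+1})^k)⁻¹·Σ_{t<L^k} ν⟨B^k-point of the start at step t, μ⟩` for `x = L^k·y + j` — the pairing `hf` on the indicator of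
the bond `(x, μ)`, (1.18) unfolded (✓`bondAvgIter_eq_blockSum`), only the direction `μ` survives, one start per step. [cite: Balaban1984PropagatorsI, (1.18) p.20] -/
theorem transpose_apply_eq_sum_starts (hk : k ≤ P.m + P.K) (ν : PBond P k → ℝ) (f : PBond P 0 → ℝ)
    (hf : ∀ Y : PBond P 0 → ℝ, ∑ c : PBond P k, ν c * bondAvgIter k Y c = ∑ b : PBond P 0, f b * Y b)
    (y : Site P k) (j : Fin P.d → Fin (P.L ^ k)) (μ : Fin P.d) :
    f ⟨blockSiteK k y j, μ⟩
      = ((((P.L : ℝ) ^ (P.d + 1)) ^ k)⁻¹) * ∑ t ∈ Finset.range (P.L ^ k), ν ⟨if t ≤ (j μ : ℕ) then y else y.unshift μ, μ⟩ := by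
  classical
  set x : Site P 0 := blockSiteK k y j with hx
  set Y : PBond P 0 → ℝ := fun b => if b = ⟨x, μ⟩ then 1 else 0 with hY
  have hR : ∑ b : PBond P 0, f b * Y b = f ⟨x, μ⟩ := by
    simp only [hY, mul_ite, mul_one, mul_zero, Finset.sum_ite_eq', Finset.mem_univ, if_true]
  have h := hf Y
  rw [hR] at h
  rw [← h]
  -- unfold (1.18) on the indicator
  have hQ : ∀ c : PBond P k, bondAvgIter k Y c
      = ((((P.L : ℝ) ^ (P.d + 1)) ^ k)⁻¹) * ∑ x' ∈ iterBlock k c.src, ∑ t ∈ Finset.range (P.L ^ k), (if (⟨runSite x' c.dir t, c.dir⟩ : PBond P 0) = ⟨x, μ⟩ then (1 : ℝ) else 0) := by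
    intro c
    rw [bondAvgIter_eq_blockSum k hk Y c, smul_eq_mul]
    rfl
  simp_rw [hQ]
  rw [sum_pbond]
  -- only the direction `μ` survives
  have hdir : ∀ (y' : Site P k) (μ' : Fin P.d), μ' ≠ μ →
      ∑ x' ∈ iterBlock k y', ∑ t ∈ Finset.range (P.L ^ k), (if (⟨runSite x' μ' t, μ'⟩ : PBond P 0) = ⟨x, μ⟩ then (1 : ℝ) else 0) = 0 := by
    intro y' μ' hμ'
    refine Finset.sum_eq_zero fun x' _ => Finset.sum_eq_zero fun t _ => ?_
    rw [if_neg]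
    intro heq
    exact hμ' (congrArg PBond.dir heq)
  have hstep1 : ∑ y' : Site P k, ∑ μ' : Fin P.d, ν ⟨y', μ'⟩ * (((((P.L : ℝ) ^ (P.d + 1)) ^ k)⁻¹) *
        ∑ x' ∈ iterBlock k y', ∑ t ∈ Finset.range (P.L ^ k), (if (⟨runSite x' μ' t, μ'⟩ : PBond P 0) = ⟨x, μ⟩ then (1 : ℝ) else 0))
      = ∑ y' : Site P k, ν ⟨y', μ⟩ * (((((P.L : ℝ) ^ (P.d + 1)) ^ k)⁻¹) *
        ∑ x' ∈ iterBlock k y', ∑ t ∈ Finset.range (P.L ^ k), (if runSite x' μ t = x then (1 : ℝ) else 0)) := by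
    refine Finset.sum_congr rfl fun y' _ => ?_
    rw [Finset.sum_eq_single μ]
    · congr 2
      refine Finset.sum_congr rfl fun x' _ => Finset.sum_congr rfl fun t _ => ?_
      by_cases hst : runSite x' μ t = x
      · rw [if_pos hst, if_pos (by rw [hst])]
      · rw [if_neg hst, if_neg (fun heq => hst (congrArg PBond.src heq))]
    · intro μ' _ hμ'
      rw [hdir y' μ' hμ', mul_zero, mul_zero]
    · intro hμ; exact absurd (Finset.mem_univ μ) hμ
  -- the sum unfolds to the statement's shape first
  show ∑ y' : Site P k, ∑ μ' : Fin P.d, ν ⟨y', μ'⟩ * (((((P.L : ℝ) ^ (P.d + 1)) ^ k)⁻¹) *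
        ∑ x' ∈ iterBlock k y', ∑ t ∈ Finset.range (P.L ^ k), (if (⟨runSite x' μ' t, μ'⟩ : PBond P 0) = ⟨x, μ⟩ then (1 : ℝ) else 0)) = _
  rw [hstep1]
  -- one start per step, in the block of `y` or of `y − e_μ`
  have hfib : ∀ (y' : Site P k) (t : ℕ), t ∈ Finset.range (P.L ^ k) →
      ∑ x' ∈ iterBlock k y', (if runSite x' μ t = x then (1 : ℝ) else 0) = if (if t ≤ (j μ : ℕ) then y else y.unshift μ) = y' then 1 else 0 := by
    intro y' t ht
    obtain ⟨x₀, hx₀, hmem⟩ := exists_start_mem_iterBlock hk y j μ (Finset.mem_range.mp ht)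
    have huniq : ∀ x', runSite x' μ t = x → x' = x₀ := fun x' h' => runSite_left_cancel μ t (h'.trans hx₀.symm)
    rw [mem_iterBlock] at hmem
    by_cases hy : (if t ≤ (j μ : ℕ) then y else y.unshift μ) = y'
    · rw [if_pos hy]
      have hx₀mem : x₀ ∈ iterBlock k y' := by rw [mem_iterBlock, hmem, hy]
      rw [Finset.sum_eq_single_of_mem x₀ hx₀mem]
      · rw [if_pos hx₀]
      · intro x' _ hne
        rw [if_neg (fun h' => hne (huniq x' h'))]
    · rw [if_neg hy]
      refine Finset.sum_eq_zero fun x' hx' => ?_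
      rw [if_neg]
      intro h'
      have hx'0 := huniq x' h'
      rw [hx'0, mem_iterBlock, hmem] at hx'
      exact hy hx'
  calc ∑ y' : Site P k, ν ⟨y', μ⟩ * (((((P.L : ℝ) ^ (P.d + 1)) ^ k)⁻¹) *
        ∑ x' ∈ iterBlock k y', ∑ t ∈ Finset.range (P.L ^ k), (if runSite x' μ t = x then (1 : ℝ) else 0))
      = ((((P.L : ℝ) ^ (P.d + 1)) ^ k)⁻¹) * ∑ t ∈ Finset.range (P.L ^ k), ∑ y' : Site P k,
          ν ⟨y', μ⟩ * ∑ x' ∈ iterBlock k y', (if runSite x' μ t = x then (1 : ℝ) else 0) := by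
        rw [Finset.sum_comm, Finset.mul_sum]
        refine Finset.sum_congr rfl fun y' _ => ?_
        rw [Finset.sum_comm, Finset.mul_sum, Finset.mul_sum, Finset.mul_sum]
        refine Finset.sum_congr rfl fun t _ => ?_
        ring
    _ = ((((P.L : ℝ) ^ (P.d + 1)) ^ k)⁻¹) * ∑ t ∈ Finset.range (P.L ^ k), ν ⟨if t ≤ (j μ : ℕ) then y else y.unshift μ, μ⟩ := by
        congr 1
        refine Finset.sum_congr rfl fun t ht => ?_
        rw [Finset.sum_congr rfl fun y' _ => by rw [hfib y' t ht]]
        simp only [mul_ite, mul_one, mul_zero, Finset.sum_ite_eq, Finset.mem_univ, if_true]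

/-- ★★★ **THE TENT FORMULA**: for `x = L^k·y + j` (`blockSiteK k y j`) and every direction `μ`,
`f⟨x,μ⟩ = ((L^{d+1})^k)⁻¹·((j_μ + 1)·ν⟨y,μ⟩ + (L^k − 1 − j_μ)·ν⟨y − e_μ, μ⟩)` — on each `k`-block the `μ`-component of the `Q_k`-transpose is AFFINE in the block coordinate `j_μ`
(and constant in the others). [cite: Balaban1984PropagatorsI, (1.18) p.20] -/
theorem transpose_blockSiteK (hk : k ≤ P.m + P.K) (ν : PBond P k → ℝ) (f : PBond P 0 → ℝ)
    (hf : ∀ Y : PBond P 0 → ℝ, ∑ c : PBond P k, ν c * bondAvgIter k Y c = ∑ b : PBond P 0, f b * Y b)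
    (y : Site P k) (j : Fin P.d → Fin (P.L ^ k)) (μ : Fin P.d) :
    f ⟨blockSiteK k y j, μ⟩
      = ((((P.L : ℝ) ^ (P.d + 1)) ^ k)⁻¹) * (((j μ : ℕ) + 1 : ℝ) * ν ⟨y, μ⟩ + (((P.L ^ k : ℕ) : ℝ) - 1 - (j μ : ℕ)) * ν ⟨y.unshift μ, μ⟩) := by
  classical
  rw [transpose_apply_eq_sum_starts hk ν f hf y j μ]
  congr 1
  have hap : ∀ t : ℕ, ν ⟨if t ≤ (j μ : ℕ) then y else y.unshift μ, μ⟩ = if t ≤ (j μ : ℕ) then ν ⟨y, μ⟩ else ν ⟨y.unshift μ, μ⟩ :=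
    fun t => by split_ifs <;> rfl
  rw [Finset.sum_congr rfl fun t _ => hap t, Finset.sum_ite, Finset.sum_const, Finset.sum_const, nsmul_eq_mul, nsmul_eq_mul]
  have hjl : (j μ : ℕ) + 1 ≤ P.L ^ k := (j μ).isLt
  have h1 : (Finset.range (P.L ^ k)).filter (fun t => t ≤ (j μ : ℕ)) = Finset.range ((j μ : ℕ) + 1) := by
    ext t
    simp only [Finset.mem_filter, Finset.mem_range]
    omega
  have h2 : ((Finset.range (P.L ^ k)).filter (fun t => ¬ t ≤ (j μ : ℕ))).card = P.L ^ k - ((j μ : ℕ) + 1) := by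
    have h := Finset.card_filter_add_card_filter_not (s := Finset.range (P.L ^ k)) (fun t => t ≤ (j μ : ℕ))
    rw [h1, Finset.card_range, Finset.card_range] at h
    omega
  rw [h1, Finset.card_range, h2, Nat.cast_sub hjl]
  push_cast
  ring

/-- ★ **THE SAME, AS `α + β·j_μ`**: `f⟨L^k·y + j, μ⟩ = α + β·j_μ` with `α = ((L^{d+1})^k)⁻¹·(ν⟨y,μ⟩ + (L^k − 1)·ν⟨y − e_μ,μ⟩)` and `β = ((L^{d+1})^k)⁻¹·(ν⟨y,μ⟩ − ν⟨y − e_μ,μ⟩)` — the form the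
interior-bump dualities of brick (2b) consume. [cite: Balaban1984PropagatorsI, (1.18) p.20] -/
theorem transpose_blockSiteK_affine (hk : k ≤ P.m + P.K) (ν : PBond P k → ℝ) (f : PBond P 0 → ℝ)
    (hf : ∀ Y : PBond P 0 → ℝ, ∑ c : PBond P k, ν c * bondAvgIter k Y c = ∑ b : PBond P 0, f b * Y b)
    (y : Site P k) (j : Fin P.d → Fin (P.L ^ k)) (μ : Fin P.d) :
    f ⟨blockSiteK k y j, μ⟩
      = ((((P.L : ℝ) ^ (P.d + 1)) ^ k)⁻¹) * (ν ⟨y, μ⟩ + (((P.L ^ k : ℕ) : ℝ) - 1) * ν ⟨y.unshift μ, μ⟩)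
        + ((((P.L : ℝ) ^ (P.d + 1)) ^ k)⁻¹) * (ν ⟨y, μ⟩ - ν ⟨y.unshift μ, μ⟩) * (j μ : ℕ) := by
  rw [transpose_blockSiteK hk ν f hf y j μ]
  ring

end Summit.QuantumFields.YangMills.Theorems.Prop7FlatTransposeTent

end
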